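import Summits.CriticalPhenomena.PercolationContinuityZ3.Theorems.PercNearOneGluingNoHeavyRsw3SlabPlateGluingOverlap
import HarnessLib

/-!
# RSW3 lane (P2, gen 13): PLATE RENORMALISATION with OVERLAPPING cells — near-certain crossings of the plates
# `{0..n+s₀} × {0..n} × {0..B}` glued by near-certain uniqueness of the boxes `{0..n} × {0..A} × {0..B}` percolate, for EVERY
# zone width `A = s₁ + n ≥ n + 1`

builds on p205010 (kernel theorem, internal audit signed; external expert review pending)

Cell `prim-rsw3`, prover seat `prim-rsw3-p2` (gen 13), memo `run/shared/lean/prim/rsw3/P2-RSWLITE.md` §19.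
Support file (`--supports stmt-CriticalPhenomena-4575`); no definitions, no named facts, no sorries.  The gen-12 criterion
`theta_pos_of_plate_slabUniq_criterion_aspect` (`…Rsw3SlabPlateRenormalizationAspect`) with the lateral cell spacing `s₁ = A - n` now
ANY positive integer (gen 12: `s₁ ≥ n + 1`, i.e. `A ≥ 2n + 1`): cells `b ∈ ℤ²`; plate `Π_b = (s₀ b₀, s₁ b₁, 0) + {0..n+s₀} × {0..n} × {0..B}`
crossed along `x₀`; uniqueness zones `Z_c = (s₀ c₀ + s₀, s₁ c₁, 0) + S`, `S = {0..n} × {0..A} × {0..B}`, for the FOUR cells `c = b - δ`,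
`δ ∈ {0,1}²`; `★`-adjacent regular cells glue in the zone indexed by `(min b₀ b₀', min b₁ b₁')` (`reachable_of_slabUniq_plates_aspect`,
whose hypotheses never compare `s₁` with `n`).  For `s₁ ≤ n` the plates of laterally adjacent cells OVERLAP and so do their source
faces; the `★`-Peierls criterion is therefore run in the finite-multiplicity form `theta_pos_of_sparse_bound_wit_fin`
(`finite_setOf_mem_plateSource`), and the footprints are separated at the range `r` with `r s₀ ≥ n + 1`, `(r+1) s₁ ≥ n + 2 s₁ + 1`
(`disjoint_plateFootprint_of_lt_supDist_overlap`).  Result, for every `p`: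

  `theta_pos_of_plate_slabUniq_criterion_overlap`:  `P_p((boxCross (n+s₀, n, B) 0)ᶜ) + 4 · P_p(TwoSpan(S)) ≤ δ_r^{(r+1)²} ⇒ θ(p) > 0`,
  `δ_r = 1/(2·((r+1)²+2)·(2·(3²+1)²)^{(r+1)²})`.

The proof is the gen-12 proof verbatim except for the two replaced ingredients (heartbeats `400000` as there).

References: M. Aizenman, Nucl. Phys. B 485 (1997) 551–582, §2 Thm. 2 and criterion (ii) [Aizenman1997]; G. Grimmett, *Percolation* (1999),
§1.6, §2.2, §7.4 [GrimmettPercolation1999]. [folklore]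
-/

noncomputable section

namespace Summit.CriticalPhenomena.PercolationContinuityZ3.Theorems.Rsw3

open MeasureTheory Literature.Probability.LatticeModels Literature.Probability.Percolation
open Literature.Probability.Percolation.KestenZhang Literature.Probability.Percolation.KozmaNitzan SimpleGraph Relation
open Summit.CriticalPhenomena.PercolationContinuityZ3.Theorems.Crossing SurfaceTension

/-! ## The criterion -/

set_option maxHeartbeats 400000 in
/-- **Plate renormalisation with overlapping cells (every `p`; `s₀, s₁ ≥ 1`, `A = s₁ + n`, range `r` with `r s₀ ≥ n + 1`,
`(r+1) s₁ ≥ n + 2 s₁ + 1`).**  With `δ_r = 1/(2·((r+1)²+2)·(2·(3²+1)²)^{(r+1)²})` and `S = {0..n} × {0..A} × {0..B} = Icc 0 (n, A, B)`: if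
`P_p((boxCross (n+s₀, n, B) 0)ᶜ) + 4 · P_p(TwoSpan(S)) ≤ δ_r^{(r+1)²}` then `θ(p) > 0` (cells as in the file header;
`theta_pos_of_sparse_bound_wit_fin`).  Aizenman's criterion (ii) without the thinness of the cells, at EVERY lateral size `A ≥ n + 1`,
`B ≥ 0`, with a range that depends on `n/s₀` and `n/s₁` only.
[cite: Aizenman1997, §2 criterion (ii) ("if (1 - R) + D is too small then there is percolation")] -/
theorem theta_pos_of_plate_slabUniq_criterion_overlap (p : unitInterval) {n s₀ s₁ A B r : ℕ} (hs₀ : 1 ≤ s₀) (hs₁ : 1 ≤ s₁)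
    (hA : s₁ + n = A) (hrs : n + 1 ≤ r * s₀) (hrs₁ : n + 2 * s₁ + 1 ≤ (r + 1) * s₁)
    (h : (bondPercolation (zdGraph 3) p).real (boxCross ![((n + s₀ : ℕ) : ℤ), (n : ℤ), (B : ℤ)] 0)ᶜ +
        4 * (bondPercolation (zdGraph 3) p).real
          {ω : BondConfig (Site 3) | ∃ x ∈ Finset.Icc (0 : Site 3) ![(n : ℤ), (A : ℤ), (B : ℤ)],
            ∃ x' ∈ Finset.Icc (0 : Site 3) ![(n : ℤ), (A : ℤ), (B : ℤ)],
            ∃ y ∈ Finset.Icc (0 : Site 3) ![(n : ℤ), (A : ℤ), (B : ℤ)],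
            ∃ y' ∈ Finset.Icc (0 : Site 3) ![(n : ℤ), (A : ℤ), (B : ℤ)],
            x 0 = 0 ∧ x' 0 = 0 ∧ y 0 = (n : ℤ) ∧ y' 0 = (n : ℤ) ∧
            ω ∈ inConn ↑(Finset.Icc (0 : Site 3) ![(n : ℤ), (A : ℤ), (B : ℤ)]) x y ∧
            ω ∈ inConn ↑(Finset.Icc (0 : Site 3) ![(n : ℤ), (A : ℤ), (B : ℤ)]) x' y' ∧
            ω ∉ inConn ↑(Finset.Icc (0 : Site 3) ![(n : ℤ), (A : ℤ), (B : ℤ)]) x x'} ≤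
      (1 / (2 * (((r : ℝ) + 1) ^ 2 + 2) * (2 * (3 ^ 2 + 1 : ℝ) ^ 2) ^ ((r + 1) ^ 2))) ^ ((r + 1) ^ 2)) :
    0 < theta (zdGraph 3) (0 : Site 3) p := by
  classical
  set μ := bondPercolation (zdGraph 3) p with hμ
  set δ : ℝ := 1 / (2 * (((r : ℝ) + 1) ^ 2 + 2) * (2 * (3 ^ 2 + 1 : ℝ) ^ 2) ^ ((r + 1) ^ 2)) with hδ
  -- adapted from `theta_pos_of_plate_slabUniq_criterion_aspect` (gen 12): free lateral spacing `s₁ ≥ 1`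
  have hs₁A' : s₁ + n = A := hA
  have hn0 : (0 : ℤ) ≤ n := by positivity
  have hs₀0 : (0 : ℤ) ≤ s₀ := by positivity
  have hs₀1 : (0 : ℤ) < s₀ := by exact_mod_cast hs₀
  have hs₁0 : (0 : ℤ) ≤ s₁ := by positivity
  have hs₁A : (s₁ : ℤ) + (n : ℤ) = (A : ℤ) := by exact_mod_cast hs₁A'
  -- base regions
  set L : Site 3 := ![((n + s₀ : ℕ) : ℤ), (n : ℤ), (B : ℤ)] with hL
  set plate₀ : Finset (Site 3) := Finset.Icc (0 : Site 3) L with hplate₀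
  set F0 : Set (Site 3) := {x | x ∈ plate₀ ∧ x 0 = 0} with hF0
  set F1 : Set (Site 3) := {x | x ∈ plate₀ ∧ x 0 = L 0} with hF1
  set slab₀ : Finset (Site 3) := Finset.Icc (0 : Site 3) ![(n : ℤ), (A : ℤ), (B : ℤ)] with hslab₀
  set V₀ : Finset (Site 3) := Finset.Icc (0 : Site 3) ![((n + s₀ : ℕ) : ℤ), 2 * (s₁ : ℤ) + (n : ℤ), (B : ℤ)] with hV₀
  have hL0 : L 0 = ((n + s₀ : ℕ) : ℤ) := by simp [hL]
  -- the two-spanning probability of the zone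
  set D := μ.real
      {ω : BondConfig (Site 3) | ∃ x ∈ slab₀, ∃ x' ∈ slab₀, ∃ y ∈ slab₀, ∃ y' ∈ slab₀,
        x 0 = 0 ∧ x' 0 = 0 ∧ y 0 = (n : ℤ) ∧ y' 0 = (n : ℤ) ∧
        ω ∈ inConn ↑slab₀ x y ∧ ω ∈ inConn ↑slab₀ x' y' ∧ ω ∉ inConn ↑slab₀ x x'} with hD
  -- shifts: plate offsets `w b` (= zone offset for `δ = (1,0)`), zone offsets `u₀₀ b`, `u₀₁ b`, footprint offsets `f b` (= zone offset for `δ = (1,1)`)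
  set w : Site 2 → Site 3 := fun b => ![(s₀ : ℤ) * b 0, (s₁ : ℤ) * b 1, 0] with hw
  set u₀₀ : Site 2 → Site 3 := fun b => ![(s₀ : ℤ) * b 0 + (s₀ : ℤ), (s₁ : ℤ) * b 1, 0] with hu₀₀
  set u₀₁ : Site 2 → Site 3 := fun b => ![(s₀ : ℤ) * b 0 + (s₀ : ℤ), (s₁ : ℤ) * b 1 - (s₁ : ℤ), 0] with hu₀₁
  set f : Site 2 → Site 3 := fun b => ![(s₀ : ℤ) * b 0, (s₁ : ℤ) * b 1 - (s₁ : ℤ), 0] with hf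
  have hw0 : ∀ b, w b 0 = (s₀ : ℤ) * b 0 := fun b => by simp [hw]
  have hw1 : ∀ b, w b 1 = (s₁ : ℤ) * b 1 := fun b => by simp [hw]
  have hw2 : ∀ b, w b 2 = 0 := fun b => by simp [hw]
  have hu₀₀0 : ∀ b, u₀₀ b 0 = (s₀ : ℤ) * b 0 + (s₀ : ℤ) := fun b => by simp [hu₀₀]
  have hu₀₀1 : ∀ b, u₀₀ b 1 = (s₁ : ℤ) * b 1 := fun b => by simp [hu₀₀]
  have hu₀₀2 : ∀ b, u₀₀ b 2 = 0 := fun b => by simp [hu₀₀]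
  have hu₀₁0 : ∀ b, u₀₁ b 0 = (s₀ : ℤ) * b 0 + (s₀ : ℤ) := fun b => by simp [hu₀₁]
  have hu₀₁1 : ∀ b, u₀₁ b 1 = (s₁ : ℤ) * b 1 - (s₁ : ℤ) := fun b => by simp [hu₀₁]
  have hu₀₁2 : ∀ b, u₀₁ b 2 = 0 := fun b => by simp [hu₀₁]
  have hf0 : ∀ b, f b 0 = (s₀ : ℤ) * b 0 := fun b => by simp [hf]
  have hf1 : ∀ b, f b 1 = (s₁ : ℤ) * b 1 - (s₁ : ℤ) := fun b => by simp [hf]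
  have hf2 : ∀ b, f b 2 = 0 := fun b => by simp [hf]
  -- the uniqueness event of the zone `slab₀ + v`
  set Uat : Site 3 → Set (BondConfig (Site 3)) := fun v =>
    {ω : BondConfig (Site 3) | ∀ x ∈ slab₀.image (· + v), ∀ x' ∈ slab₀.image (· + v), ∀ y ∈ slab₀.image (· + v),
      ∀ y' ∈ slab₀.image (· + v), x 0 = v 0 → x' 0 = v 0 → y 0 = v 0 + (n : ℤ) → y' 0 = v 0 + (n : ℤ) →
      ω ∈ inConn ↑(slab₀.image (· + v)) x y → ω ∈ inConn ↑(slab₀.image (· + v)) x' y' →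
      ω ∈ inConn ↑(slab₀.image (· + v)) x x'} with hUat
  -- cells
  set plate : Site 2 → Finset (Site 3) := fun b => plate₀.image (· + w b) with hplate
  set V : Site 2 → Finset (Site 3) := fun b => V₀.image (· + f b) with hV
  set C : Site 2 → Set (BondConfig (Site 3)) := fun b =>
    linked ((zdShiftIso (w b)) '' (↑plate₀ : Set (Site 3))) ((zdShiftIso (w b)) '' F0) ((zdShiftIso (w b)) '' F1) with hC
  set good : Site 2 → Set (BondConfig (Site 3)) := fun b =>
    C b ∩ (Uat (u₀₀ b) ∩ Uat (w b) ∩ Uat (u₀₁ b) ∩ Uat (f b)) with hgood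
  set src : Site 2 → Set (Site 3) := fun b => (zdShiftIso (w b)) '' F0 with hsrc
  set Wit : BondConfig (Site 3) → Site 2 → Site 3 → Prop := fun ω b x =>
    x 0 = w b 0 ∧ x ∈ plate b ∧ ∃ y : Site 3, y 0 = w b 0 + ((n + s₀ : ℕ) : ℤ) ∧
      ω ∈ inConn ↑(plate b) x y with hWit
  have himg_plate : ∀ b, (zdShiftIso (w b)) '' (↑plate₀ : Set (Site 3)) = ↑(plate b) := by
    intro b; simp only [hplate]; rw [Finset.coe_image]; rfl
  have hmem_plate₀ : ∀ x : Site 3, x ∈ plate₀ ↔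
      (0 ≤ x 0 ∧ x 0 ≤ ((n + s₀ : ℕ) : ℤ)) ∧ (0 ≤ x 1 ∧ x 1 ≤ n) ∧ (0 ≤ x 2 ∧ x 2 ≤ (B : ℤ)) := by
    intro x; rw [hplate₀, hL]; exact mem_Icc_zero_vec3_iff
  -- the source at the origin, as a finset
  set src₀ : Finset (Site 3) := (plate₀.filter fun x => x 0 = 0).image (· + w 0) with hsrc₀
  have hsrc0 : src 0 = ↑src₀ := by
    simp only [hsrc, hsrc₀]
    rw [Finset.coe_image, Finset.coe_filter]
    ext x
    simp only [Set.mem_image, Set.mem_setOf_eq, hF0, zdShiftIso_apply]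
  have hne : src₀.Nonempty := by
    refine (Finset.image_nonempty).2 ⟨0, ?_⟩
    rw [Finset.mem_filter, hmem_plate₀]
    refine ⟨?_, rfl⟩
    simp only [Pi.zero_apply]
    refine ⟨⟨le_rfl, by positivity⟩, ⟨le_rfl, hn0⟩, le_rfl, by positivity⟩
  -- smallness of `δ`
  have hδ0 : 0 ≤ δ := by rw [hδ]; positivity
  have hδ1 : 2 * (((r : ℝ) + 1) ^ 2 + 2) * (2 * (3 ^ 2 + 1 : ℝ) ^ 2) ^ ((r + 1) ^ 2) * δ ≤ 1 := by
    have hpos : 0 < 2 * (((r : ℝ) + 1) ^ 2 + 2) * (2 * (3 ^ 2 + 1 : ℝ) ^ 2) ^ ((r + 1) ^ 2) := by positivity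
    rw [hδ, mul_one_div_cancel hpos.ne']
  refine theta_pos_of_sparse_bound_wit_fin p (src := src) (good := good) (Wit := Wit) src₀ hsrc0 hne ?_ ?_ ?_
    (r := r) hδ0 hδ1 ?_
  · -- a regular cell is crossed from its source
    intro ω b hb
    obtain ⟨hcr, -⟩ := hb
    have hcr' : ω ∈ linked ((zdShiftIso (w b)) '' (↑plate₀ : Set (Site 3))) ((zdShiftIso (w b)) '' F0)
        ((zdShiftIso (w b)) '' F1) := hcr
    rw [mem_linked_iff] at hcr'
    obtain ⟨x, hx, _, ⟨y₀, ⟨hy₀, hy₀0⟩, rfl⟩, hxy⟩ := hcr'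
    refine ⟨x, hx, ?_, ?_, (zdShiftIso (w b)) y₀, ?_, ?_⟩
    · obtain ⟨x₀, ⟨-, hx₀0⟩, rfl⟩ := hx
      rw [zdShiftIso_apply, Pi.add_apply, hx₀0, zero_add]
    · obtain ⟨x₀, ⟨hx₀, -⟩, rfl⟩ := hx
      rw [← Finset.mem_coe, ← himg_plate b]
      exact ⟨x₀, Finset.mem_coe.2 hx₀, rfl⟩
    · rw [zdShiftIso_apply, Pi.add_apply, hy₀0, hL0, add_comm]
    · rw [← himg_plate b]; exact hxy
  · -- gluing of ★-neighbours: the zone indexed by `(min b₀ b₀', min b₁ b₁')` is one of the four zones of `b`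
    intro ω b b' hbb' hb hb' x x' hWx hWx'
    obtain ⟨hx0, hx, y, hy0, hxy⟩ := hWx
    obtain ⟨hx'0, hx', y', hy'0, hx'y'⟩ := hWx'
    obtain ⟨-, ⟨⟨hU₀₀, hU₁₀⟩, hU₀₁⟩, hU₁₁⟩ := hb
    have e0 := abs_sub_le_one_of_supDist_le_one hbb' 0
    have e1 := abs_sub_le_one_of_supDist_le_one hbb' 1
    -- multiplied bounds
    have m0a : (s₀ : ℤ) * b' 0 ≤ (s₀ : ℤ) * b 0 + (s₀ : ℤ) := by
      have := mul_le_mul_of_nonneg_left e0.1 hs₀0; linarith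
    have m0b : (s₀ : ℤ) * b 0 ≤ (s₀ : ℤ) * b' 0 + (s₀ : ℤ) := by
      have := mul_le_mul_of_nonneg_left e0.2 hs₀0; linarith
    have m1a : (s₁ : ℤ) * b' 1 ≤ (s₁ : ℤ) * b 1 + (s₁ : ℤ) := by
      have := mul_le_mul_of_nonneg_left e1.1 hs₁0; linarith
    have m1b : (s₁ : ℤ) * b 1 ≤ (s₁ : ℤ) * b' 1 + (s₁ : ℤ) := by
      have := mul_le_mul_of_nonneg_left e1.2 hs₁0; linarith
    have hgn : (((n + s₀ : ℕ) : ℤ)) = (n : ℤ) + (s₀ : ℤ) := by push_cast; ring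
    have hb0 := hw0 b; have hb1 := hw1 b; have hb'0 := hw0 b'; have hb'1 := hw1 b'
    rcases le_or_gt (b 0) (b' 0) with h0le | h0lt
    · have m0 : (s₀ : ℤ) * b 0 ≤ (s₀ : ℤ) * b' 0 := mul_le_mul_of_nonneg_left h0le hs₀0
      rcases le_or_gt (b 1) (b' 1) with h1le | h1lt
      · have m1 : (s₁ : ℤ) * b 1 ≤ (s₁ : ℤ) * b' 1 := mul_le_mul_of_nonneg_left h1le hs₁0
        have c0 := hu₀₀0 b; have c1 := hu₀₀1 b
        exact reachable_of_slabUniq_plates_aspect (n := n) (g := n + s₀) (A := A) (B := B) (v := u₀₀ b) (u := w b) (u' := w b')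
          (hu₀₀2 b) (hw2 b) (hw2 b') (by rw [c0, hb0]; linarith) (by rw [c0, hb0, hgn]; linarith)
          (by rw [c1, hb1]) (by rw [c1, hb1]; linarith) (by rw [c0, hb'0]; linarith) (by rw [c0, hb'0, hgn]; linarith)
          (by rw [c1, hb'1]; exact m1) (by rw [c1, hb'1]; linarith) hU₀₀ hx0 hy0 hx'0 hy'0 hx hx' hxy hx'y'
      · have h1' : b' 1 + 1 ≤ b 1 := h1lt
        have m1 : (s₁ : ℤ) * b' 1 + (s₁ : ℤ) ≤ (s₁ : ℤ) * b 1 := by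
          have := mul_le_mul_of_nonneg_left h1' hs₁0; linarith
        have c0 := hu₀₁0 b; have c1 := hu₀₁1 b
        exact reachable_of_slabUniq_plates_aspect (n := n) (g := n + s₀) (A := A) (B := B) (v := u₀₁ b) (u := w b) (u' := w b')
          (hu₀₁2 b) (hw2 b) (hw2 b') (by rw [c0, hb0]; linarith) (by rw [c0, hb0, hgn]; linarith)
          (by rw [c1, hb1]; linarith) (by rw [c1, hb1]; linarith) (by rw [c0, hb'0]; linarith) (by rw [c0, hb'0, hgn]; linarith)
          (by rw [c1, hb'1]; linarith) (by rw [c1, hb'1]; linarith) hU₀₁ hx0 hy0 hx'0 hy'0 hx hx' hxy hx'y'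
    · have h0' : b' 0 + 1 ≤ b 0 := h0lt
      have m0 : (s₀ : ℤ) * b' 0 + (s₀ : ℤ) ≤ (s₀ : ℤ) * b 0 := by
        have := mul_le_mul_of_nonneg_left h0' hs₀0; linarith
      rcases le_or_gt (b 1) (b' 1) with h1le | h1lt
      · have m1 : (s₁ : ℤ) * b 1 ≤ (s₁ : ℤ) * b' 1 := mul_le_mul_of_nonneg_left h1le hs₁0
        exact reachable_of_slabUniq_plates_aspect (n := n) (g := n + s₀) (A := A) (B := B) (v := w b) (u := w b) (u' := w b')
          (hw2 b) (hw2 b) (hw2 b') le_rfl (by rw [hb0, hgn]; linarith)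
          le_rfl (by rw [hb1]; linarith) (by rw [hb0, hb'0]; linarith) (by rw [hb0, hb'0, hgn]; linarith)
          (by rw [hb1, hb'1]; exact m1) (by rw [hb1, hb'1]; linarith) hU₁₀ hx0 hy0 hx'0 hy'0 hx hx' hxy hx'y'
      · have h1' : b' 1 + 1 ≤ b 1 := h1lt
        have m1 : (s₁ : ℤ) * b' 1 + (s₁ : ℤ) ≤ (s₁ : ℤ) * b 1 := by
          have := mul_le_mul_of_nonneg_left h1' hs₁0; linarith
        have c0 := hf0 b; have c1 := hf1 b
        exact reachable_of_slabUniq_plates_aspect (n := n) (g := n + s₀) (A := A) (B := B) (v := f b) (u := w b) (u' := w b')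
          (hf2 b) (hw2 b) (hw2 b') (by rw [c0, hb0]) (by rw [c0, hb0, hgn]; linarith)
          (by rw [c1, hb1]; linarith) (by rw [c1, hb1]; linarith) (by rw [c0, hb'0]; linarith) (by rw [c0, hb'0, hgn]; linarith)
          (by rw [c1, hb'1]; linarith) (by rw [c1, hb'1]; linarith) hU₁₁ hx0 hy0 hx'0 hy'0 hx hx' hxy hx'y'
  · -- every vertex lies in the sources of finitely many cells
    intro x
    exact finite_setOf_mem_plateSource (n := n) (B := B) hs₀ hs₁ x
  · -- the sparse product bound
    intro T hT
    -- locality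
    have hplateV : ∀ b, plate b ⊆ V b := fun b => plate_subset_footprint n s₀ s₁ B b
    have hZV : ∀ b, ∀ v : Site 3, (v = u₀₀ b ∨ v = w b ∨ v = u₀₁ b ∨ v = f b) → slab₀.image (· + v) ⊆ V b := by
      intro b v hv
      rcases hv with rfl | rfl | rfl | rfl
      · exact zone_subset_footprint (B := B) hs₁A b (ζ₀ := (s₀ : ℤ) * b 0 + (s₀ : ℤ)) (ζ₁ := (s₁ : ℤ) * b 1)
          (by linarith) le_rfl (by linarith) le_rfl
      · exact zone_subset_footprint (B := B) hs₁A b (ζ₀ := (s₀ : ℤ) * b 0) (ζ₁ := (s₁ : ℤ) * b 1)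
          le_rfl (by linarith) (by linarith) le_rfl
      · exact zone_subset_footprint (B := B) hs₁A b (ζ₀ := (s₀ : ℤ) * b 0 + (s₀ : ℤ)) (ζ₁ := (s₁ : ℤ) * b 1 - (s₁ : ℤ))
          (by linarith) le_rfl le_rfl (by linarith)
      · exact zone_subset_footprint (B := B) hs₁A b (ζ₀ := (s₀ : ℤ) * b 0) (ζ₁ := (s₁ : ℤ) * b 1 - (s₁ : ℤ))
          le_rfl (by linarith) le_rfl (by linarith)
    have hdetC : ∀ b, DeterminedBy (C b) (↑(edgesIn (zdGraph 3) (V b)) : Set (Sym2 (Site 3))) := by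
      intro b
      show DeterminedBy (linked ((zdShiftIso (w b)) '' (↑plate₀ : Set (Site 3))) ((zdShiftIso (w b)) '' F0)
        ((zdShiftIso (w b)) '' F1)) _
      rw [himg_plate b]
      exact (determinedBy_linked_edgesIn (plate b) _ _).mono (coe_edgesIn_mono (hplateV b))
    have hdetUat : ∀ b, ∀ v : Site 3, (v = u₀₀ b ∨ v = w b ∨ v = u₀₁ b ∨ v = f b) →
        DeterminedBy (Uat v) (↑(edgesIn (zdGraph 3) (V b)) : Set (Sym2 (Site 3))) := by
      intro b v hv
      exact (determinedBy_slabUniqAt n (v 0) (slab₀.image (· + v))).mono (coe_edgesIn_mono (hZV b v hv))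
    have hdetgood : ∀ b, DeterminedBy (good b) (↑(edgesIn (zdGraph 3) (V b)) : Set (Sym2 (Site 3))) := by
      intro b
      exact (hdetC b).inter ((((hdetUat b _ (Or.inl rfl)).inter (hdetUat b _ (Or.inr (Or.inl rfl)))).inter
        (hdetUat b _ (Or.inr (Or.inr (Or.inl rfl))))).inter (hdetUat b _ (Or.inr (Or.inr (Or.inr rfl)))))
    have hdet : ∀ b ∈ T, DeterminedBy (good b)ᶜ (↑(edgesIn (zdGraph 3) (V b)) : Set (Sym2 (Site 3))) :=
      fun b _ => (hdetgood b).compl'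
    have hdisj : (↑T : Set (Site 2)).PairwiseDisjoint
        (fun b => (↑(edgesIn (zdGraph 3) (V b)) : Set (Sym2 (Site 3)))) := by
      intro b hb b' hb' hne'
      exact disjoint_edgesIn_of_disjoint (disjoint_plateFootprint_of_lt_supDist_overlap hrs hrs₁ (hT b hb b' hb' hne'))
    rw [bondPercolation_real_biInter_eq_prod (zdGraph 3) p T (fun b => (good b)ᶜ) _ hdet
      (fun b hb => (hdet b hb).measurableSet_of_finset) hdisj]
    -- each factor is at most `δ^((r+1)²)`
    have hCm : ∀ b, MeasurableSet (C b) := fun b => measurableSet_linked _ _ _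
    have hPC : ∀ b, μ.real (C b)ᶜ ≤ μ.real (boxCross L 0)ᶜ := by
      intro b
      have himg := real_linked_image (zdShiftIso (w b)) p (↑plate₀ : Set (Site 3)) F0 F1
      rw [← hμ] at himg
      have e : μ.real (C b) = μ.real (linked (↑plate₀ : Set (Site 3)) F0 F1) := by rw [hC]; exact himg
      have hle : μ.real (boxCross L 0) ≤ μ.real (linked (↑plate₀ : Set (Site 3)) F0 F1) := by
        rw [hF0, hF1, hplate₀]; exact real_boxCross_le_real_linked_faces p L 0
      rw [probReal_compl_eq_one_sub (hCm b), probReal_compl_eq_one_sub (measurableSet_boxCross L 0), e]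
      linarith
    have hPU : ∀ v : Site 3, μ.real (Uat v)ᶜ ≤ D := by
      intro v
      have hrel := bondPercolation_real_preimage_relabel_iso (zdShiftIso v) p (Uat v)ᶜ
      rw [Set.preimage_compl] at hrel
      have hpre : BondConfig.relabel (sym2Equiv (zdShiftIso v).toEquiv) ⁻¹' (Uat v) =
          {ω | ∀ x ∈ slab₀, ∀ x' ∈ slab₀, ∀ y ∈ slab₀, ∀ y' ∈ slab₀, x 0 = 0 → x' 0 = 0 → y 0 = (n : ℤ) → y' 0 = (n : ℤ) →
            ω ∈ inConn ↑slab₀ x y → ω ∈ inConn ↑slab₀ x' y' → ω ∈ inConn ↑slab₀ x x'} :=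
        preimage_relabel_slabUniqAt n slab₀ v
      rw [hpre, ← hμ] at hrel
      rw [← hrel, hD]
      exact measureReal_mono (compl_slabUniq_subset n slab₀) (measure_ne_top _ _)
    have hfac : ∀ b ∈ T, μ.real (good b)ᶜ ≤ δ ^ ((r + 1) ^ 2) := by
      intro b _
      have h4 : μ.real (good b)ᶜ ≤ μ.real (C b)ᶜ + (μ.real (Uat (u₀₀ b))ᶜ + μ.real (Uat (w b))ᶜ +
          μ.real (Uat (u₀₁ b))ᶜ + μ.real (Uat (f b))ᶜ) := by
        simp only [hgood]
        rw [Set.compl_inter]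
        refine (measureReal_union_le _ _).trans (add_le_add le_rfl ?_)
        rw [Set.compl_inter]
        refine (measureReal_union_le _ _).trans (add_le_add ?_ le_rfl)
        rw [Set.compl_inter]
        refine (measureReal_union_le _ _).trans (add_le_add ?_ le_rfl)
        rw [Set.compl_inter]
        exact measureReal_union_le _ _
      have h5 : μ.real (C b)ᶜ + (μ.real (Uat (u₀₀ b))ᶜ + μ.real (Uat (w b))ᶜ +
          μ.real (Uat (u₀₁ b))ᶜ + μ.real (Uat (f b))ᶜ) ≤ μ.real (boxCross L 0)ᶜ + 4 * D := by
        have a1 := hPU (u₀₀ b); have a2 := hPU (w b); have a3 := hPU (u₀₁ b); have a4 := hPU (f b)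
        have a0 := hPC b
        linarith
      have h6 : μ.real (boxCross L 0)ᶜ + 4 * D ≤ δ ^ ((r + 1) ^ 2) := h
      exact h4.trans (h5.trans h6)
    calc ∏ b ∈ T, μ.real (good b)ᶜ ≤ ∏ _b ∈ T, δ ^ ((r + 1) ^ 2) :=
          Finset.prod_le_prod (fun b _ => measureReal_nonneg) hfac
      _ = δ ^ ((r + 1) ^ 2 * T.card) := by rw [Finset.prod_const, ← pow_mul]

end Summit.CriticalPhenomena.PercolationContinuityZ3.Theorems.Rsw3

end
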